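import Literature.Probability.Percolation.AnnulusAlternation
import HarnessLib

/-!
# Frontier chains: the closed clusters of the two chains sit on either side of the second arm

Topic `Literature/Probability/Percolation`; family `crit-perc` / near-critical percolation on `𝕋`.
Sequel of `AnnulusAlternation.lean` (order extraction for the four-arm separation theorem with
alternating colours, Nolin 2008, Thm. 11, `j = 4`, `σ = BWBW`). There, around `∂Λ_N` and
anticlockwise from `τ₁`, all sites of the component `U` of the second open arm precede all sites of
the cluster `Cl` of the first (`annFrontier_order`). For the fenced tips of Kesten's surgery one
needs the finer block structure INSIDE `U`: the closed cluster of the first chain (through `τ₁`)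
precedes every open site reachable from `s₂`, which precedes the closed cluster of the second chain
(through `τ₂`) — so that any choice of tips in the four clusters is in the alternating cyclic
order `W B W B`. Both are one more application of `triBall_not_interleaved_shift` with the path
`open arm · hole · open arm`.

* `annFrontier_block_one` — `PathIn (A ∖ ω) τ₁ k`, `PathIn (A ∩ ω) s₂ c`, `|k| = |c| = N` ⟹
  `hexShift τ₁ k < hexShift τ₁ c`;
* `annFrontier_block_two` — `PathIn (A ∖ ω) τ₂ k`, `PathIn (A ∩ ω) s₂ c`, `|k| = |c| = N` ⟹
  `hexShift τ₁ c < hexShift τ₁ k`.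

Everything here is proved; no named facts are introduced.

## References

* P. Nolin, *Near-critical percolation in two dimensions*, Electron. J. Probab. 13 (2008), §4.1, Thm. 11
  [arXiv 0711.4948: Thm. 10]. [Nolin2008]
* B. Bollobás, O. Riordan, *Percolation*, CUP (2006), Ch. 7 Lemma 5. [BollobasRiordan2006]
-/

noncomputable section

open Finset

namespace Literature.Probability.Percolation

open LatticeModels

variable {n N : ℕ} {ω : SiteConfig (Site 2)} {s₁ s₂ : Site 2}

/-- The path `c ⇝ s₂ → hole ⇝ s₁ ⇝ t₁` of open annulus sites and hole sites, as a path of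
`Λ_N ∖ (A ∖ ω)`, from any open site `c` reachable from `s₂` to the tip `t₁` of the first arm. [folklore] -/
theorem pathIn_open_hole_open (hn : 1 ≤ n) {t₁ c : Site 2}
    (hB₁ : PathIn triGraph (triAnn n N ∩ ω) s₁ t₁) (hs₁ : triNorm s₁ = n)
    (hc : PathIn triGraph (triAnn n N ∩ ω) s₂ c) (hs₂ : triNorm s₂ = n) :
    PathIn triGraph ((↑(triBall N) : Set (Site 2)) ∩ (triAnn n N \ ω)ᶜ) c t₁ := by
  set B : Set (Site 2) := triAnn n N \ ω with hB
  have openB : ∀ {a b : Site 2}, PathIn triGraph (triAnn n N ∩ ω) a b →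
      PathIn triGraph ((↑(triBall N) : Set (Site 2)) ∩ Bᶜ) a b := fun hp =>
    hp.mono fun z hz => ⟨Finset.mem_coe.2 (mem_triBall_iff.2 (mem_triAnn.1 hz.1).2), fun h => h.2 hz.2⟩
  have holeB : ∀ z : Site 2, triNorm z < n → z ∈ (↑(triBall N) : Set (Site 2)) ∩ Bᶜ := fun z hz =>
    ⟨Finset.mem_coe.2 (mem_triBall_iff.2 (by
      have := (mem_triAnn.1 hB₁.left_mem.1).2; omega)), fun h => by have := (mem_triAnn.1 h.1).1; omega⟩
  obtain ⟨g₁, hadj₁, hg₁⟩ := exists_adj_mem_triBall_sub_one hn hs₁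
  obtain ⟨g₂, hadj₂, hg₂⟩ := exists_adj_mem_triBall_sub_one hn hs₂
  have hg₁' : triNorm g₁ < n := by have := hg₁; push_cast [Nat.cast_sub hn] at this; omega
  have hg₂' : triNorm g₂ < n := by have := hg₂; push_cast [Nat.cast_sub hn] at this; omega
  have phole : PathIn triGraph ((↑(triBall N) : Set (Site 2)) ∩ Bᶜ) g₂ g₁ :=
    (pathIn_triBall hg₂ hg₁).mono fun z hz => holeB z (by
      have := mem_triBall_iff.1 (Finset.mem_coe.1 hz); push_cast [Nat.cast_sub hn] at this; omega)
  exact ((((openB hc).symm.tail hadj₂ (holeB g₂ hg₂')).trans phole).trans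
    (PathIn.of_adj (holeB g₁ hg₁') (openB hB₁).left_mem hadj₁.symm)).trans (openB hB₁)

/-- **First block**: a closed site `k` of `∂Λ_N` joined to `τ₁` by a closed path of the annulus comes,
anticlockwise from `τ₁`, BEFORE every open site `c` of `∂Λ_N` reachable from `s₂` (else the
quadruple `τ₁ < c < k < t₁` would interleave a closed path `τ₁ ⇝ k` with `c ⇝ s₂ → hole ⇝ s₁ ⇝ t₁`). [cite: BollobasRiordan2006, Ch. 7 Lemma 5 p. 169] -/
theorem annFrontier_block_one (hn : 1 ≤ n) (hnN : n + 2 ≤ N) {t₁ : Site 2}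
    (hB₁ : PathIn triGraph (triAnn n N ∩ ω) s₁ t₁) (hs₁ : triNorm s₁ = n) (ht₁ : triNorm t₁ = N)
    (hs₂ : triNorm s₂ = n) (hsep : ¬ PathIn triGraph (triAnn n N ∩ ω) s₁ s₂)
    (F : FrontierChains n N ω s₁ s₂) {k c : Site 2}
    (hk : PathIn triGraph (triAnn n N \ ω) F.τ₁ k) (hkN : triNorm k = N)
    (hc : PathIn triGraph (triAnn n N ∩ ω) s₂ c) (hcN : triNorm c = N) :
    hexShift N F.τ₁ k < hexShift N F.τ₁ c := by
  have hN : 1 ≤ N := by omega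
  obtain ⟨hI, hII, hIII, hIV⟩ := annFrontier_order hn hnN F
  have hcU : c ∈ annComp n N ω s₁ s₂ := mem_annComp_of_pathIn hsep hc
  -- `k` lies in the component `U` (the closed path from `τ₁ ∈ U` avoids the cluster)
  have hτ₁U : F.τ₁ ∈ annComp n N ω s₁ s₂ := annFrontier_subset_annComp F.chain₁.right_mem
  have hkU : k ∈ annComp n N ω s₁ s₂ :=
    hτ₁U.trans (hk.mono fun z hz => ⟨hz.1, fun hzCl => hz.2 (annCluster_subset hzCl).2⟩)
  by_contra hle
  rw [not_lt] at hle
  have hne : hexShift N F.τ₁ c ≠ hexShift N F.τ₁ k := fun e =>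
    hk.right_mem.2 ((hexShift_injOn hN hcN hkN e) ▸ hc.right_mem.2)
  have hlt : hexShift N F.τ₁ c < hexShift N F.τ₁ k := lt_of_le_of_ne hle hne
  obtain ⟨h0, -⟩ := hIV c hcU hc.right_mem.2 hcN
  have h3 : hexShift N F.τ₁ k < hexShift N F.τ₁ t₁ :=
    lt_of_le_of_lt (hII k hkU hkN) (hIII t₁ hB₁ ht₁)
  have hP : PathIn triGraph ((↑(triBall N) : Set (Site 2)) ∩ (triAnn n N \ ω)) F.τ₁ k :=
    hk.mono fun z hz => ⟨Finset.mem_coe.2 (mem_triBall_iff.2 (mem_triAnn.1 hz.1).2), hz⟩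
  exact triBall_not_interleaved_shift hN (triAnn n N \ ω) F.norm_τ₁ F.norm_τ₁ hcN hkN ht₁
    (by rw [hexShift_self]; exact h0) hlt h3 hP (pathIn_open_hole_open hn hB₁ hs₁ hc hs₂)

/-- **Second block**: a closed site `k` of `∂Λ_N` joined to `τ₂` by a closed path of the annulus
comes AFTER every open site `c` of `∂Λ_N` reachable from `s₂` (else `k < c < τ₂ < t₁` would
interleave `k ⇝ τ₂` with `c ⇝ s₂ → hole ⇝ s₁ ⇝ t₁`). [cite: BollobasRiordan2006, Ch. 7 Lemma 5 p. 169] -/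
theorem annFrontier_block_two (hn : 1 ≤ n) (hnN : n + 2 ≤ N) {t₁ : Site 2}
    (hB₁ : PathIn triGraph (triAnn n N ∩ ω) s₁ t₁) (hs₁ : triNorm s₁ = n) (ht₁ : triNorm t₁ = N)
    (hs₂ : triNorm s₂ = n) (hsep : ¬ PathIn triGraph (triAnn n N ∩ ω) s₁ s₂)
    (F : FrontierChains n N ω s₁ s₂) {k c : Site 2}
    (hk : PathIn triGraph (triAnn n N \ ω) F.τ₂ k) (hkN : triNorm k = N)
    (hc : PathIn triGraph (triAnn n N ∩ ω) s₂ c) (hcN : triNorm c = N) :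
    hexShift N F.τ₁ c < hexShift N F.τ₁ k := by
  have hN : 1 ≤ N := by omega
  obtain ⟨-, -, hIII, hIV⟩ := annFrontier_order hn hnN F
  have hcU : c ∈ annComp n N ω s₁ s₂ := mem_annComp_of_pathIn hsep hc
  by_contra hle
  rw [not_lt] at hle
  have hne : hexShift N F.τ₁ k ≠ hexShift N F.τ₁ c := fun e =>
    hk.right_mem.2 ((hexShift_injOn hN hkN hcN e) ▸ hc.right_mem.2)
  have hlt : hexShift N F.τ₁ k < hexShift N F.τ₁ c := lt_of_le_of_ne hle hne
  obtain ⟨-, h1⟩ := hIV c hcU hc.right_mem.2 hcN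
  have h3 : hexShift N F.τ₁ F.τ₂ < hexShift N F.τ₁ t₁ := hIII t₁ hB₁ ht₁
  have hP : PathIn triGraph ((↑(triBall N) : Set (Site 2)) ∩ (triAnn n N \ ω)) k F.τ₂ :=
    hk.symm.mono fun z hz => ⟨Finset.mem_coe.2 (mem_triBall_iff.2 (mem_triAnn.1 hz.1).2), hz⟩
  exact triBall_not_interleaved_shift hN (triAnn n N \ ω) F.norm_τ₁ hkN hcN F.norm_τ₂ ht₁
    hlt h1 h3 hP (pathIn_open_hole_open hn hB₁ hs₁ hc hs₂)

end Literature.Probability.Percolation
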